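import Literature.NumberTheory.ComplexMultiplication.CosetGermEndomorphismKernel
import Literature.NumberTheory.ComplexMultiplication.CMGaloisSubfield
import HarnessLib

/-!
# Milne 1999 §6 pp. 68–69: the Galois setting of the completion of the proof of THEOREM 6.1 —
# `K = Q·F`, `Γ = Gal(K/ℚ) = Γ₀ × ⟨ι⟩`, `Γ₀ = Gal(K/Q) ≅ Gal(F/ℚ)`, `D = D(w₀)`, `(D : 1) = [K_{w₀} : ℚ_p]`,
# `Γ/D ≅ {primes of K over p}` via `τ ↦ τw₀`, «because `p` splits in `Q`, `D ⊂ Γ₀`» — the number-theoretic `CosetGerm.Setting`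
# (J. S. Milne, *Lefschetz motives and the Tate conjecture*, Compositio Math. 117 (1999), §6 p. 68 last lines – p. 69 L17)

Family `hodge`, lane `lit-hodgefound` (Layer A3; seat `lit-hodgefound-p27`, generation 18, row g18-#1); topic
`Literature/NumberTheory/ComplexMultiplication`, namespace `Literature.NumberTheory.ComplexMultiplication.CMNumbers` (the number-theoretic
side of the seat's Milne-1999 series, g15/g16).  g17-#2 `CosetGermEndomorphismKernel` introduced the ABSTRACT `CosetGerm.Setting ι Γ₀ D`
(«`Γ = Γ₀ × ⟨ι⟩`, `D ⊂ Γ₀`» for a finite group) on which g17-#2…#5 run the completion of the proof of THEOREM 6.1 (LEMMAS 6.7–6.10, the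
right-hand square, THEOREM 6.1 at level `K` on characters).  THIS FILE supplies the NUMBER-THEORETIC INSTANCE the print starts from: a CM
field `K`, Galois over `ℚ`, containing an imaginary quadratic field `Q` in which `p` splits, a prime `w₀ | p` of `K`, `Γ = Gal(K/ℚ)`,
`ι` = complex conjugation, `Γ₀ = Gal(K/Q)`, `D = D(w₀)`.  Definitions with bodies (`fixingSubgroupProdZpowersHom/Equiv`,
`fixingSubgroupEquivQuotient`, `fixingSubgroupEquivAutReal`, `decompositionGroup`, `cosetsEquivPrimesOver`) + THEOREMS; no named fact
(D-0026, net debt 0).  Everything here is Galois theory and the splitting of primes; no abelian variety, no motive — nothing in this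
file is a case of the Hodge conjecture or of Tate's.

THE PRINT.  [Milne1999] §6 p. 68 L-2 – p. 69 L17 (held `paper:doi-10-1023-a-1000776613765` p0024 L106–L119, p0025 L5–L33), verbatim:
«Completion of the proof of the Theorem 6.1. It suffices to prove that [`X^*(T^K) → X^*(S^K)` over `X^*(L^K) → X^*(P^K)`] is almost
Cartesian for all sufficiently large CM-fields `K ⊂ ℚ^{al}` of finite degree over `ℚ`. We shall in fact prove it under the assumption
that `K` – is finite and Galois over `ℚ`, – contains a quadratic imaginary extension `Q` of `ℚ` in which `(p)` splits, – and is not equal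
to `Q`.  Thus `K = Q · F` with `F` totally real, and `Γ =_{df} Gal(K/ℚ)`, `Γ = Γ₀ × ⟨ι⟩`, `Γ₀ =_{df} Gal(K/Q) ≅ Gal(F/ℚ)`.  As a subfield
of `ℚ^{al}`, `K` acquires a prime `w₀`. Let `D = D(w₀) ⊂ Γ` be the decomposition group of `w₀`. Because `p` splits in `Q`, `D ⊂ Γ₀`.
Write `Γ₀ = {τ₀ = 1, …, τ_{n−1}}`, so that `Γ = {τ₀, …, τ_{n−1}, ιτ₀, …, ιτ_{n−1}}`.  Let `d = (D : 1)`. We can assume that the `τ_i` have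
been numbered so that `D = {τ₀, …, τ_{d−1}}` and `τ_iD = τ_{d[i/d]}D` … In particular, `{τ₀, τ_d, …}` is a set of representatives for
the cosets of `D` in `Γ`.  We shall use the map `τ ↦ τw₀` to identify `Γ/D` with the set of primes of `K` lying over `p`.»

DICTIONARY.  `K` is a number field, CM (`IsCMField K`) and Galois over `ℚ` (`IsGalois ℚ K`); `Γ = Gal(K/ℚ)` is Mathlib's `K ≃ₐ[ℚ] K`;
`ι ∈ Γ` is the tree's `conjGal` (`EmbeddingActionFaithful`: Mathlib's `IsCMField.complexConj K` over `ℚ`; central, `conjGal_central`;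
`ι² = 1`, `conjGal_mul_conjGal`), `⟨ι⟩ = Subgroup.zpowers conjGal = {1, ι}`.  Milne's `Q ⊂ K` is an intermediate field
`Q : IntermediateField ℚ K`; «quadratic imaginary» = `finrank ℚ Q = 2 ∧ ¬IsTotallyReal Q` (equivalently `ι ∉ Gal(K/Q)`,
`conjGal_not_mem_fixingSubgroup_iff` — a subfield of a Galois CM field is totally real or CM, `CMGaloisSubfield`);
`Γ₀ = Gal(K/Q) = Q.fixingSubgroup ⊂ Γ` (Mathlib `IntermediateField.fixingSubgroup`); `F = K^{⟨ι⟩} = fixedField ⟨ι⟩`, which IS the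
maximal real subfield `K⁺` (`fixedField_zpowers_conjGal_toSubfield`; «`F` totally real», `isTotallyReal_fixedField_zpowers_conjGal`);
«`K = Q · F`» = `Q ⊔ F = ⊤` in the lattice of intermediate fields (with `Q ⊓ F = ⊥`: linearly disjoint compositum);
«`Γ = Γ₀ × ⟨ι⟩`» = the multiplication isomorphism `Γ₀ × ⟨ι⟩ ≃* Γ` (`fixingSubgroupProdZpowersEquiv`; `Γ₀ ∩ ⟨ι⟩ = 1`, `Γ₀⟨ι⟩ = Γ`,
`ι` central); «`Γ₀ ≅ Gal(F/ℚ)`» = `fixingSubgroupEquivAutReal : Γ₀ ≃* (F ≃ₐ[ℚ] F)`, `τ ↦ τ|F` (`coe_fixingSubgroupEquivAutReal_apply`),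
through `Γ₀ ≃* Γ/⟨ι⟩` (`fixingSubgroupEquivQuotient`) and Mathlib's `IsGalois.normalAutEquivQuotient`.  The prime `w₀` is a prime
`𝔭` of `𝓞_K` over `p` in the g16 spelling (`(p : ℕ) (𝔭 : Ideal (𝓞 K)) [𝔭.IsPrime] [𝔭.LiesOver (p)]`, `w₀ = basePrime p 𝔭 ∈ Y`,
`Y = primesOverSet p K` = Mathlib `Ideal.primesOver (p) (𝓞 K)` with the `galRestrict` action of `Gal(K/ℚ)`, g16-#1);
«`D = D(w₀)` the decomposition group» = `decompositionGroup p 𝔭 = MulAction.stabilizer Γ w₀` (as in Mathlib's Hilbert theory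
`IsDecompositionField`); «`d = (D : 1)`» = `Nat.card D = localDegree 𝔭 = e(w₀/p)·f(w₀/p) = [K_{w₀} : ℚ_p]` (`card_decompositionGroup`,
g16-#1 `localDegree`, g16-#3 `card_fibre_basePrime`); «identify `Γ/D` with the set of primes of `K` lying over `p`» =
`cosetsEquivPrimesOver : Γ ⧸ D ≃ Y`, `τD ↦ τw₀` (orbit–stabilizer + transitivity of `Gal(K/ℚ)` on `Y`, g16-#3), `Γ`-equivariant
(`cosetsEquivPrimesOver_smul`).  «`(p)` splits in `Q`» ([Q : ℚ] = 2) = «`p𝓞_Q` is the product of TWO DISTINCT primes» = there are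
exactly two primes of `𝓞_Q` over `p`: `((p).primesOver (𝓞 Q)).ncard = 2` ([NeukirchANT1999] Ch. I (8.3): `Σ eᵢfᵢ = [Q : ℚ] = 2`, so
two primes iff `e = f = 1` iff `p` is (totally) split); `𝓞 Q` = Mathlib's ring of integers of the number field `↥Q`, with
`Algebra (𝓞 Q) (𝓞 K)`, and the prime of `Q` below an ideal `P` of `𝓞_K` is `P.under (𝓞 Q) = P ∩ 𝓞_Q`.

THE PROOF OF «because `p` splits in `Q`, `D ⊂ Γ₀`» (Milne gives no detail; [NeukirchANT1999] Ch. I §9).  Let `v₀ = w₀ ∩ Q` and let `v ≠ v₀`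
be the other prime of `Q` over `p`.  An automorphism `τ ∈ Γ₀ = Gal(K/Q)` does not move the prime of `Q` below an ideal:
`(τP) ∩ Q = P ∩ Q` (`under_smul_of_mem_fixingSubgroup`), and `[Q : ℚ] = 2`, `ι ∉ Γ₀` give `Γ = Γ₀ ⊔ ιΓ₀` (`mem_or_conjGal_mul_mem`, an
index-`2` subgroup).  Choose a prime `w | v` of `K`; it lies over `p`, so `w = σw₀` for some `σ ∈ Γ` (`Γ` is transitive on `Y`); `σ ∉ Γ₀`
(else `w ∩ Q = v₀`), hence `σ = ιτ` with `τ ∈ Γ₀` and `(ιw₀) ∩ Q = (τ(ιw₀)) ∩ Q = (σw₀) ∩ Q = v` (`ι` central).  If `δ ∈ D` were not in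
`Γ₀`, then `δ = ιτ′` with `τ′ ∈ Γ₀` and `v₀ = (δw₀) ∩ Q = (ιw₀) ∩ Q = v` — a contradiction (`decompositionGroup_le_fixingSubgroup`).
Milne's third assumption «`K ≠ Q`» (i.e. `Γ₀ ≠ 1`) is not needed for the `Setting` and is not assumed here.

WHAT IS HERE (all PROVED):
* §1 (`Q ⊂ K` any intermediate field of the Galois CM field `K`): **`conjGal_mem_fixingSubgroup_iff`** (`ι ∈ Gal(K/Q) ⟺ Q` totally real),
  `conjGal_not_mem_fixingSubgroup_iff`, **`index_fixingSubgroup_eq_finrank`** (`(Γ : Γ₀) = [Q : ℚ]`), `index_fixingSubgroup_eq_two`,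
  **`mem_or_conjGal_mul_mem`** (`Γ = Γ₀ ∪ ιΓ₀` for `[Q : ℚ] = 2`, `ι ∉ Γ₀`), `mem_zpowers_conjGal_iff` (`⟨ι⟩ = {1, ι}`), instance
  `zpowers_conjGal_normal`, **`fixingSubgroup_inf_zpowers_conjGal`** (`Γ₀ ∩ ⟨ι⟩ = 1`), **`fixingSubgroup_sup_zpowers_conjGal`** (`Γ₀⟨ι⟩ = Γ`),
  DEF `fixingSubgroupProdZpowersHom` (`_apply`, `_bijective`), DEF **`fixingSubgroupProdZpowersEquiv : Γ₀ × ⟨ι⟩ ≃* Γ`** (`_apply`) —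
  «`Γ = Γ₀ × ⟨ι⟩`».
* §2 (`F = K^{⟨ι⟩}`): `mem_fixedField_zpowers_conjGal_iff`, **`fixedField_zpowers_conjGal_toSubfield`** (`F = K⁺`),
  **`isTotallyReal_fixedField_zpowers_conjGal`**, instance `isGalois_fixedField_zpowers_conjGal`, `fixingSubgroup_fixedField_zpowers_conjGal`
  (`Gal(K/F) = ⟨ι⟩`), **`sup_fixedField_zpowers_conjGal_eq_top`** («`K = Q · F`»), `inf_fixedField_zpowers_conjGal_eq_bot` (`Q ∩ F = ℚ`),
  `finrank_fixedField_zpowers_conjGal` (`[K : F] = 2`), `quotientMk_comp_subtype_bijective`, DEF `fixingSubgroupEquivQuotient : Γ₀ ≃* Γ/⟨ι⟩`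
  (`_apply`), DEF **`fixingSubgroupEquivAutReal : Γ₀ ≃* Gal(F/ℚ)`** («`Γ₀ ≅ Gal(F/ℚ)`»; `coe_fixingSubgroupEquivAutReal_apply : (τ|F)(x) = τ(x)`).
* §3 (`w₀ = 𝔭 | p`): DEF **`decompositionGroup p 𝔭 = D(w₀)`** (`mem_decompositionGroup_iff`, `mem_decompositionGroup_iff_smul_eq`),
  **`card_decompositionGroup : (D : 1) = [K_{w₀} : ℚ_p]`**, DEF **`cosetsEquivPrimesOver : Γ/D ≃ Y`** (**`cosetsEquivPrimesOver_mk : τD ↦ τw₀`**,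
  `cosetsEquivPrimesOver_smul`), `card_primesOverSet_mul_card_decompositionGroup` (`|Y|·(D : 1) = [K : ℚ]`), `under_smul_of_mem_fixingSubgroup`,
  `under_conjGal_mul_smul`, `under_mem_primesOver`, **`decompositionGroup_le_fixingSubgroup`** («because `p` splits in `Q`, `D ⊂ Γ₀`»).
* §4: **`cosetGermSetting_of_le`** (the `Setting` for any `D ⊂ Γ₀`), **`cosetGermSetting : CosetGerm.Setting conjGal (Gal(K/Q)) (D(w₀))`** — THE
  NUMBER-THEORETIC INSTANCE of g17-#2's `Setting` under the printed hypotheses — and, read back: `conjGal_not_mem_decompositionGroup` (`ι ∉ D`),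
  **`conjGal_smul_ne`** (`ι` fixes no prime of `K` above `p`), `isCMTypeWith_fixingSubgroup` (`Γ₀` is a CM type on `Γ` for `ι`, skel-3's
  `IsCMTypeWith`, so Lemma 3.3's basis `ψ_i, ψ̄` of g17-#2 applies).

NOT here: the numbering `τ_iD = τ_{d[i/d]}D` (g17-#2 `halfCosets`/`frame` do the bookkeeping abstractly); Lemma 5.1's commutative diagram
`X^*(S^K) ↪ ℤ[Γ]`, `X^*(P^K) → ℤ[Γ/D]` in these coordinates (the dictionary between g16-#3's `alphaCharIn`/`fInvLim` and g17-#3's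
`serreLattice`/`alphaP` — the next row); THEOREM 6.1 for the group schemes and the limit over `K` (Layer B, B5-09).

## References

* [Milne1999] J. S. Milne, *Lefschetz motives and the Tate conjecture*, Compositio Math. 117 (1999) 45–76 — §6 p. 68 L-2 – p. 69 L17
  (held `paper:doi-10-1023-a-1000776613765` p0024 L106–L119, p0025 L5–L33).
* [NeukirchANT1999] J. Neukirch, *Algebraic Number Theory*, Springer 1999 — Ch. I (8.3) (`Σ eᵢfᵢ = n`, split primes), Ch. I §9
  (decomposition group `G_𝔓 = {σ | σ𝔓 = 𝔓}`, transitivity of the Galois group on the primes over `𝔭`, `|G_𝔓| = e·f`).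

Provenance: lane `lit-hodgefound`, seat `lit-hodgefound-p27` gen 18 (agent `literature-prover-lit-hodgefound-p27-g18-0`), row g18-#1.
-/

set_option autoImplicit false

noncomputable section

open scoped NumberField Pointwise

namespace Literature.NumberTheory.ComplexMultiplication

namespace CMNumbers

open _root_.NumberField IntermediateField

/-! ### §1 `Γ₀ = Gal(K/Q)`, `ι ∉ Γ₀`, `(Γ : Γ₀) = [Q : ℚ]`, and `Γ = Γ₀ ⊔ ιΓ₀` for `[Q : ℚ] = 2` -/

section Galois

variable {K : Type} [Field K] [NumberField K] [IsCMField K] [IsGalois ℚ K] (Q : IntermediateField ℚ K)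

/-- **`ι ∈ Gal(K/Q)` iff `Q` is totally real**: complex conjugation of the Galois CM field `K` fixes the subfield `Q`
pointwise iff `ι|Q = 1` iff `Q ⊂ K⁺` (the tree's `isTotallyReal_iff_conjGalRestrict_eq_one`).  So for Milne's «quadratic
imaginary extension `Q` of `ℚ`» one has `ι ∉ Γ₀ = Gal(K/Q)`. [cite: Milne1999, §6 p. 69 L1–L3] -/
theorem conjGal_mem_fixingSubgroup_iff : (conjGal : K ≃ₐ[ℚ] K) ∈ Q.fixingSubgroup ↔ IsTotallyReal Q := by
  rw [isTotallyReal_iff_conjGalRestrict_eq_one, IntermediateField.mem_fixingSubgroup_iff]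
  constructor
  · intro h
    ext x
    exact h x x.2
  · intro h x hx
    simpa using congrArg (fun e : Q ≃ₐ[ℚ] Q => ((e ⟨x, hx⟩ : Q) : K)) h

/-- `ι ∉ Gal(K/Q)` iff `Q` is not totally real (e.g. `Q` imaginary quadratic). [cite: Milne1999, §6 p. 69 L1–L3] -/
theorem conjGal_not_mem_fixingSubgroup_iff : (conjGal : K ≃ₐ[ℚ] K) ∉ Q.fixingSubgroup ↔ ¬IsTotallyReal Q :=
  (conjGal_mem_fixingSubgroup_iff Q).not

omit [IsCMField K] in
/-- **`(Γ : Γ₀) = [Q : ℚ]`** for `Γ₀ = Gal(K/Q) ⊂ Γ = Gal(K/ℚ)` (`|Γ| = [K : ℚ]`, `|Γ₀| = [K : Q]`). [cite: Milne1999, §6 p. 69 L1–L3] -/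
theorem index_fixingSubgroup_eq_finrank : Q.fixingSubgroup.index = Module.finrank ℚ Q := by
  have h1 : Q.fixingSubgroup.index * Nat.card Q.fixingSubgroup = Nat.card (K ≃ₐ[ℚ] K) := Subgroup.index_mul_card _
  rw [IsGalois.card_fixingSubgroup_eq_finrank, IsGalois.card_aut_eq_finrank, ← Module.finrank_mul_finrank ℚ Q K] at h1
  exact Nat.eq_of_mul_eq_mul_right Module.finrank_pos h1

omit [IsCMField K] in
/-- For `[Q : ℚ] = 2` the subgroup `Γ₀ = Gal(K/Q)` has index `2`. [cite: Milne1999, §6 p. 69 L1–L3] -/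
theorem index_fixingSubgroup_eq_two (hQ : Module.finrank ℚ Q = 2) : Q.fixingSubgroup.index = 2 := by
  rw [index_fixingSubgroup_eq_finrank, hQ]

/-- **`Γ = Γ₀ ⊔ ιΓ₀`**: if `[Q : ℚ] = 2` and `ι ∉ Γ₀` then every `γ ∈ Γ` lies in `Γ₀` or in `ιΓ₀` («`Γ = {τ₀, …, τ_{n−1}, ιτ₀, …,
ιτ_{n−1}}`»). [cite: Milne1999, §6 p. 69 L1–L3, L10–L11] -/
theorem mem_or_conjGal_mul_mem (hQ : Module.finrank ℚ Q = 2) (hι : (conjGal : K ≃ₐ[ℚ] K) ∉ Q.fixingSubgroup)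
    (γ : K ≃ₐ[ℚ] K) : γ ∈ Q.fixingSubgroup ∨ conjGal * γ ∈ Q.fixingSubgroup := by
  by_cases hγ : γ ∈ Q.fixingSubgroup
  · exact Or.inl hγ
  · exact Or.inr ((Subgroup.mul_mem_iff_of_index_two (index_fixingSubgroup_eq_two Q hQ)).2 (iff_of_false hι hγ))

omit [IsGalois ℚ K] in
/-- The subgroup `⟨ι⟩ = {1, ι}` of `Γ` (`ι² = 1`). [cite: Milne1999, §6 p. 69 L2 («Γ = Γ₀ × ⟨ι⟩»)] -/
theorem mem_zpowers_conjGal_iff (g : K ≃ₐ[ℚ] K) : g ∈ Subgroup.zpowers (conjGal : K ≃ₐ[ℚ] K) ↔ g = 1 ∨ g = conjGal := by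
  constructor
  · rintro ⟨k, rfl⟩
    have h2 : (conjGal : K ≃ₐ[ℚ] K) ^ (2 : ℤ) = 1 := by
      rw [zpow_two]; exact conjGal_mul_conjGal
    obtain ⟨m, rfl | rfl⟩ := Int.even_or_odd' k
    · left
      change (conjGal : K ≃ₐ[ℚ] K) ^ (2 * m) = 1
      rw [zpow_mul, h2, one_zpow]
    · right
      change (conjGal : K ≃ₐ[ℚ] K) ^ (2 * m + 1) = conjGal
      rw [zpow_add, zpow_mul, h2, one_zpow, one_mul, zpow_one]
  · rintro (rfl | rfl)
    · exact one_mem _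
    · exact Subgroup.mem_zpowers _

omit [IsGalois ℚ K] in
/-- `⟨ι⟩` is central, hence normal, in `Γ`. [cite: Milne1999, §6 p. 69 L2] -/
instance zpowers_conjGal_normal : (Subgroup.zpowers (conjGal : K ≃ₐ[ℚ] K)).Normal := by
  refine ⟨fun n hn g => ?_⟩
  rcases (mem_zpowers_conjGal_iff n).1 hn with rfl | rfl
  · rw [mul_one, mul_inv_cancel]; exact one_mem _
  · rw [← conjGal_central g, mul_inv_cancel_right]
    exact Subgroup.mem_zpowers _

omit [IsGalois ℚ K] in
/-- **`Γ₀ ∩ ⟨ι⟩ = 1`** (`ι ∉ Γ₀`). [cite: Milne1999, §6 p. 69 L2 («Γ = Γ₀ × ⟨ι⟩»)] -/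
theorem fixingSubgroup_inf_zpowers_conjGal (hι : (conjGal : K ≃ₐ[ℚ] K) ∉ Q.fixingSubgroup) :
    Q.fixingSubgroup ⊓ Subgroup.zpowers (conjGal : K ≃ₐ[ℚ] K) = ⊥ := by
  rw [eq_bot_iff]
  rintro g ⟨hg, hg'⟩
  rcases (mem_zpowers_conjGal_iff g).1 hg' with rfl | rfl
  · exact one_mem _
  · exact (hι hg).elim

/-- **`Γ₀ · ⟨ι⟩ = Γ`** for `[Q : ℚ] = 2`, `ι ∉ Γ₀`. [cite: Milne1999, §6 p. 69 L2 («Γ = Γ₀ × ⟨ι⟩»)] -/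
theorem fixingSubgroup_sup_zpowers_conjGal (hQ : Module.finrank ℚ Q = 2) (hι : (conjGal : K ≃ₐ[ℚ] K) ∉ Q.fixingSubgroup) :
    Q.fixingSubgroup ⊔ Subgroup.zpowers (conjGal : K ≃ₐ[ℚ] K) = ⊤ := by
  rw [eq_top_iff]
  intro γ _
  rcases mem_or_conjGal_mul_mem Q hQ hι γ with hγ | hγ
  · exact Subgroup.mem_sup_left hγ
  · have : γ = conjGal * (conjGal * γ) := by rw [← mul_assoc, conjGal_mul_conjGal, one_mul]
    rw [this]
    exact Subgroup.mul_mem _ (Subgroup.mem_sup_right (Subgroup.mem_zpowers _)) (Subgroup.mem_sup_left hγ)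

/-- Multiplication `Γ₀ × ⟨ι⟩ → Γ`, `(τ, ε) ↦ τε` — a homomorphism because `⟨ι⟩` is central. [cite: Milne1999, §6 p. 69 L2] -/
def fixingSubgroupProdZpowersHom : Q.fixingSubgroup × Subgroup.zpowers (conjGal : K ≃ₐ[ℚ] K) →* (K ≃ₐ[ℚ] K) where
  toFun x := (x.1 : K ≃ₐ[ℚ] K) * x.2
  map_one' := by simp
  map_mul' x y := by
    -- `(τε)(τ′ε′) = (ττ′)(εε′)` because `ε ∈ ⟨ι⟩` is central
    have hc : (x.2 : K ≃ₐ[ℚ] K) * y.1 = y.1 * x.2 := by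
      rcases (mem_zpowers_conjGal_iff (x.2 : K ≃ₐ[ℚ] K)).1 x.2.2 with h | h
      · rw [h, one_mul, mul_one]
      · rw [h]; exact conjGal_central _
    change (↑(x.1 * y.1) : K ≃ₐ[ℚ] K) * ↑(x.2 * y.2) = (↑x.1 * ↑x.2) * (↑y.1 * ↑y.2)
    rw [Subgroup.coe_mul, Subgroup.coe_mul, mul_assoc, mul_assoc, ← mul_assoc (y.1 : K ≃ₐ[ℚ] K), ← hc, mul_assoc]

omit [IsGalois ℚ K] in
/-- [cite: Milne1999, §6 p. 69 L2] -/
@[simp] theorem fixingSubgroupProdZpowersHom_apply (x : Q.fixingSubgroup × Subgroup.zpowers (conjGal : K ≃ₐ[ℚ] K)) :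
    fixingSubgroupProdZpowersHom Q x = (x.1 : K ≃ₐ[ℚ] K) * x.2 := rfl

/-- `Γ₀ × ⟨ι⟩ → Γ` is a bijection for `[Q : ℚ] = 2`, `ι ∉ Γ₀` (`Γ₀ ∩ ⟨ι⟩ = 1`, `Γ = Γ₀ ⊔ ιΓ₀`). [cite: Milne1999, §6 p. 69 L2] -/
theorem fixingSubgroupProdZpowersHom_bijective (hQ : Module.finrank ℚ Q = 2)
    (hι : (conjGal : K ≃ₐ[ℚ] K) ∉ Q.fixingSubgroup) : Function.Bijective (fixingSubgroupProdZpowersHom Q) := by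
  constructor
  · rintro ⟨a, c⟩ ⟨a', c'⟩ h
    simp only [fixingSubgroupProdZpowersHom_apply] at h
    have hmem : ((a' : K ≃ₐ[ℚ] K)⁻¹ * a) ∈ Q.fixingSubgroup ⊓ Subgroup.zpowers (conjGal : K ≃ₐ[ℚ] K) := by
      refine ⟨Subgroup.mul_mem _ (Subgroup.inv_mem _ a'.2) a.2, ?_⟩
      have : (a' : K ≃ₐ[ℚ] K)⁻¹ * a = c' * (c : K ≃ₐ[ℚ] K)⁻¹ := by
        rw [inv_mul_eq_iff_eq_mul, ← mul_assoc, ← h, mul_inv_cancel_right]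
      rw [this]
      exact Subgroup.mul_mem _ c'.2 (Subgroup.inv_mem _ c.2)
    rw [fixingSubgroup_inf_zpowers_conjGal Q hι, Subgroup.mem_bot, inv_mul_eq_one] at hmem
    have ha : a = a' := Subtype.ext hmem.symm
    subst ha
    have hc : c = c' := Subtype.ext (mul_left_cancel h)
    rw [hc]
  · intro γ
    rcases mem_or_conjGal_mul_mem Q hQ hι γ with hγ | hγ
    · exact ⟨(⟨γ, hγ⟩, 1), by simp⟩
    · refine ⟨(⟨conjGal * γ, hγ⟩, ⟨conjGal, Subgroup.mem_zpowers _⟩), ?_⟩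
      rw [fixingSubgroupProdZpowersHom_apply]
      change conjGal * γ * conjGal = γ
      rw [mul_assoc, ← conjGal_central γ, ← mul_assoc, conjGal_mul_conjGal, one_mul]

/-- **«`Γ = Γ₀ × ⟨ι⟩`»**: `Γ₀ × ⟨ι⟩ ≃* Γ = Gal(K/ℚ)`, `(τ, ε) ↦ τε` (`ι` central, `ι ∉ Γ₀ = Gal(K/Q)`, `(Γ : Γ₀) = [Q : ℚ] = 2`).
[cite: Milne1999, §6 p. 69 L2] -/
def fixingSubgroupProdZpowersEquiv (hQ : Module.finrank ℚ Q = 2) (hι : (conjGal : K ≃ₐ[ℚ] K) ∉ Q.fixingSubgroup) :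
    Q.fixingSubgroup × Subgroup.zpowers (conjGal : K ≃ₐ[ℚ] K) ≃* (K ≃ₐ[ℚ] K) :=
  MulEquiv.ofBijective (fixingSubgroupProdZpowersHom Q) (fixingSubgroupProdZpowersHom_bijective Q hQ hι)

/-- [cite: Milne1999, §6 p. 69 L2] -/
@[simp] theorem fixingSubgroupProdZpowersEquiv_apply (hQ : Module.finrank ℚ Q = 2)
    (hι : (conjGal : K ≃ₐ[ℚ] K) ∉ Q.fixingSubgroup) (x : Q.fixingSubgroup × Subgroup.zpowers (conjGal : K ≃ₐ[ℚ] K)) :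
    fixingSubgroupProdZpowersEquiv Q hQ hι x = (x.1 : K ≃ₐ[ℚ] K) * x.2 := rfl

/-! ### §2 «`K = Q · F` with `F` totally real» and «`Γ₀ ≅ Gal(F/ℚ)`»: `F = K^{⟨ι⟩} = K⁺` -/

/-- **`F = K^{⟨ι⟩}` is the maximal real subfield `K⁺`**: `x` is fixed by `ι` iff `x ∈ K⁺` (Mathlib
`IsCMField.complexConj_eq_self_iff`). [cite: Milne1999, §6 p. 69 L1 («K = Q · F with F totally real»)] -/
theorem mem_fixedField_zpowers_conjGal_iff (x : K) :
    x ∈ fixedField (Subgroup.zpowers (conjGal : K ≃ₐ[ℚ] K)) ↔ x ∈ maximalRealSubfield K := by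
  rw [IntermediateField.mem_fixedField_iff, ← IsCMField.complexConj_eq_self_iff K x]
  constructor
  · intro h
    exact h conjGal (Subgroup.mem_zpowers _)
  · intro h g hg
    rcases (mem_zpowers_conjGal_iff g).1 hg with rfl | rfl
    · rfl
    · exact h

/-- `K^{⟨ι⟩} = K⁺` as subfields of `K`. [cite: Milne1999, §6 p. 69 L1] -/
theorem fixedField_zpowers_conjGal_toSubfield :
    (fixedField (Subgroup.zpowers (conjGal : K ≃ₐ[ℚ] K))).toSubfield = maximalRealSubfield K :=
  Subfield.ext fun x => mem_fixedField_zpowers_conjGal_iff x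

/-- **`F = K^{⟨ι⟩}` is totally real** (`ι|F = 1`). [cite: Milne1999, §6 p. 69 L1 («with F totally real»)] -/
theorem isTotallyReal_fixedField_zpowers_conjGal : IsTotallyReal (fixedField (Subgroup.zpowers (conjGal : K ≃ₐ[ℚ] K))) := by
  rw [isTotallyReal_iff_conjGalRestrict_eq_one]
  ext x
  rw [coe_conjGalRestrict_apply, AlgEquiv.one_apply]
  exact (IntermediateField.mem_fixedField_iff _ _).1 x.2 conjGal (Subgroup.mem_zpowers _)

/-- `F = K^{⟨ι⟩}` is Galois over `ℚ` (`⟨ι⟩` is normal). [cite: Milne1999, §6 p. 69 L2–L3 («Γ₀ ≅ Gal(F/ℚ)»)] -/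
instance isGalois_fixedField_zpowers_conjGal : IsGalois ℚ (fixedField (Subgroup.zpowers (conjGal : K ≃ₐ[ℚ] K))) :=
  IsGalois.of_fixedField_normal_subgroup _

omit [IsGalois ℚ K] in
/-- `Gal(K/F) = ⟨ι⟩` for `F = K^{⟨ι⟩}` (Galois correspondence). [cite: Milne1999, §6 p. 69 L1–L3] -/
theorem fixingSubgroup_fixedField_zpowers_conjGal :
    (fixedField (Subgroup.zpowers (conjGal : K ≃ₐ[ℚ] K))).fixingSubgroup = Subgroup.zpowers conjGal :=
  IntermediateField.fixingSubgroup_fixedField _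

/-- **«`K = Q · F`»**: for `ι ∉ Gal(K/Q)` the compositum of `Q` and `F = K⁺` is `K` (`Gal(K/QF) = Γ₀ ∩ ⟨ι⟩ = 1`).
[cite: Milne1999, §6 p. 69 L1] -/
theorem sup_fixedField_zpowers_conjGal_eq_top (hι : (conjGal : K ≃ₐ[ℚ] K) ∉ Q.fixingSubgroup) :
    Q ⊔ fixedField (Subgroup.zpowers (conjGal : K ≃ₐ[ℚ] K)) = ⊤ := by
  have h : (Q ⊔ fixedField (Subgroup.zpowers (conjGal : K ≃ₐ[ℚ] K))).fixingSubgroup = ⊥ := by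
    rw [eq_bot_iff]
    calc (Q ⊔ fixedField (Subgroup.zpowers (conjGal : K ≃ₐ[ℚ] K))).fixingSubgroup
        ≤ Q.fixingSubgroup ⊓ (fixedField (Subgroup.zpowers (conjGal : K ≃ₐ[ℚ] K))).fixingSubgroup :=
          le_inf (IntermediateField.fixingSubgroup_le le_sup_left) (IntermediateField.fixingSubgroup_le le_sup_right)
      _ = ⊥ := by rw [fixingSubgroup_fixedField_zpowers_conjGal, fixingSubgroup_inf_zpowers_conjGal Q hι]
  rw [← IsGalois.fixedField_fixingSubgroup (Q ⊔ fixedField (Subgroup.zpowers (conjGal : K ≃ₐ[ℚ] K))), h,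
    IntermediateField.fixedField_bot]

/-- `Q ∩ F = ℚ` for `[Q : ℚ] = 2`, `ι ∉ Gal(K/Q)` (`Gal(K/Q ∩ F) ⊇ Γ₀⟨ι⟩ = Γ`): `Q` and `F` are linearly disjoint with compositum `K`.
[cite: Milne1999, §6 p. 69 L1] -/
theorem inf_fixedField_zpowers_conjGal_eq_bot (hQ : Module.finrank ℚ Q = 2) (hι : (conjGal : K ≃ₐ[ℚ] K) ∉ Q.fixingSubgroup) :
    Q ⊓ fixedField (Subgroup.zpowers (conjGal : K ≃ₐ[ℚ] K)) = ⊥ := by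
  have h : (Q ⊓ fixedField (Subgroup.zpowers (conjGal : K ≃ₐ[ℚ] K))).fixingSubgroup = ⊤ := by
    rw [eq_top_iff]
    calc (⊤ : Subgroup (K ≃ₐ[ℚ] K)) = Q.fixingSubgroup ⊔ (fixedField (Subgroup.zpowers (conjGal : K ≃ₐ[ℚ] K))).fixingSubgroup := by
          rw [fixingSubgroup_fixedField_zpowers_conjGal, fixingSubgroup_sup_zpowers_conjGal Q hQ hι]
      _ ≤ (Q ⊓ fixedField (Subgroup.zpowers (conjGal : K ≃ₐ[ℚ] K))).fixingSubgroup :=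
          sup_le (IntermediateField.fixingSubgroup_le inf_le_left) (IntermediateField.fixingSubgroup_le inf_le_right)
  rw [← IsGalois.fixedField_fixingSubgroup (Q ⊓ fixedField (Subgroup.zpowers (conjGal : K ≃ₐ[ℚ] K))), h,
    IsGalois.fixedField_top]

omit [IsGalois ℚ K] in
/-- `[K : F] = 2`. [cite: Milne1999, §6 p. 69 L1–L3] -/
theorem finrank_fixedField_zpowers_conjGal :
    Module.finrank (fixedField (Subgroup.zpowers (conjGal : K ≃ₐ[ℚ] K))) K = 2 := by
  rw [IntermediateField.finrank_fixedField_eq_card, Nat.card_zpowers, orderOf_eq_prime (p := 2)]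
  · rw [pow_two]; exact conjGal_mul_conjGal
  · exact conjGal_ne_one

/-- **`Γ₀ → Γ/⟨ι⟩` is an isomorphism** (`Γ₀ ∩ ⟨ι⟩ = 1`, `Γ = Γ₀⟨ι⟩`): the group-theoretic content of «`Γ = Γ₀ × ⟨ι⟩`,
`Γ₀ ≅ Gal(F/ℚ)`». [cite: Milne1999, §6 p. 69 L2–L3] -/
theorem quotientMk_comp_subtype_bijective (hQ : Module.finrank ℚ Q = 2) (hι : (conjGal : K ≃ₐ[ℚ] K) ∉ Q.fixingSubgroup) :
    Function.Bijective ((QuotientGroup.mk' (Subgroup.zpowers (conjGal : K ≃ₐ[ℚ] K))).comp Q.fixingSubgroup.subtype) := by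
  constructor
  · rw [← MonoidHom.ker_eq_bot_iff, eq_bot_iff]
    intro τ hτ
    rw [MonoidHom.mem_ker, MonoidHom.comp_apply, Subgroup.subtype_apply, QuotientGroup.mk'_apply,
      QuotientGroup.eq_one_iff] at hτ
    have : (τ : K ≃ₐ[ℚ] K) ∈ Q.fixingSubgroup ⊓ Subgroup.zpowers (conjGal : K ≃ₐ[ℚ] K) := ⟨τ.2, hτ⟩
    rw [fixingSubgroup_inf_zpowers_conjGal Q hι, Subgroup.mem_bot] at this
    exact Subtype.ext this
  · intro q
    induction q using QuotientGroup.induction_on with | H σ => ?_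
    rcases mem_or_conjGal_mul_mem Q hQ hι σ with hσ | hσ
    · exact ⟨⟨σ, hσ⟩, rfl⟩
    · refine ⟨⟨conjGal * σ, hσ⟩, ?_⟩
      have hinv : (conjGal : K ≃ₐ[ℚ] K)⁻¹ = conjGal := inv_eq_of_mul_eq_one_right conjGal_mul_conjGal
      rw [MonoidHom.comp_apply, Subgroup.subtype_apply, QuotientGroup.mk'_apply, QuotientGroup.eq, mul_inv_rev, hinv,
        mul_assoc, conjGal_central σ, ← mul_assoc, inv_mul_cancel, one_mul]
      exact Subgroup.mem_zpowers _

/-- `Γ₀ = Gal(K/Q) ≃* Γ/⟨ι⟩`. [cite: Milne1999, §6 p. 69 L2–L3] -/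
def fixingSubgroupEquivQuotient (hQ : Module.finrank ℚ Q = 2) (hι : (conjGal : K ≃ₐ[ℚ] K) ∉ Q.fixingSubgroup) :
    Q.fixingSubgroup ≃* (K ≃ₐ[ℚ] K) ⧸ Subgroup.zpowers (conjGal : K ≃ₐ[ℚ] K) :=
  MulEquiv.ofBijective _ (quotientMk_comp_subtype_bijective Q hQ hι)

/-- [cite: Milne1999, §6 p. 69 L2–L3] -/
@[simp] theorem fixingSubgroupEquivQuotient_apply (hQ : Module.finrank ℚ Q = 2) (hι : (conjGal : K ≃ₐ[ℚ] K) ∉ Q.fixingSubgroup)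
    (τ : Q.fixingSubgroup) : fixingSubgroupEquivQuotient Q hQ hι τ = ((τ : K ≃ₐ[ℚ] K) : (K ≃ₐ[ℚ] K) ⧸ Subgroup.zpowers (conjGal : K ≃ₐ[ℚ] K)) :=
  rfl

/-- **«`Γ₀ = Gal(K/Q) ≅ Gal(F/ℚ)`»**, `τ ↦ τ|F` for `F = K⁺ = K^{⟨ι⟩}`: the composite of `Γ₀ ≃* Γ/⟨ι⟩` with Mathlib's
`Γ/⟨ι⟩ ≃* Gal(K^{⟨ι⟩}/ℚ)` (`IsGalois.normalAutEquivQuotient`, restriction to the normal subfield). [cite: Milne1999, §6 p. 69 L2–L3] -/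
def fixingSubgroupEquivAutReal (hQ : Module.finrank ℚ Q = 2) (hι : (conjGal : K ≃ₐ[ℚ] K) ∉ Q.fixingSubgroup) :
    Q.fixingSubgroup ≃* (fixedField (Subgroup.zpowers (conjGal : K ≃ₐ[ℚ] K)) ≃ₐ[ℚ] fixedField (Subgroup.zpowers (conjGal : K ≃ₐ[ℚ] K))) :=
  (fixingSubgroupEquivQuotient Q hQ hι).trans (IsGalois.normalAutEquivQuotient (Subgroup.zpowers (conjGal : K ≃ₐ[ℚ] K)))

/-- `(τ|F)(x) = τ(x)` for `τ ∈ Γ₀`, `x ∈ F`. [cite: Milne1999, §6 p. 69 L2–L3] -/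
theorem coe_fixingSubgroupEquivAutReal_apply (hQ : Module.finrank ℚ Q = 2) (hι : (conjGal : K ≃ₐ[ℚ] K) ∉ Q.fixingSubgroup)
    (τ : Q.fixingSubgroup) (x : fixedField (Subgroup.zpowers (conjGal : K ≃ₐ[ℚ] K))) :
    ((fixingSubgroupEquivAutReal Q hQ hι τ x : fixedField (Subgroup.zpowers (conjGal : K ≃ₐ[ℚ] K))) : K) = (τ : K ≃ₐ[ℚ] K) x :=
  AlgEquiv.restrictNormalHom_apply _ (τ : K ≃ₐ[ℚ] K) x

end Galois

/-! ### §3 `D = D(w₀)`, `(D : 1) = [K_{w₀} : ℚ_p]`, `Γ/D ≅ {w | p}` («the map `τ ↦ τw₀`»), and «because `p` splits in `Q`, `D ⊂ Γ₀`» -/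

section Primes

variable {K : Type} [Field K] [NumberField K] [IsCMField K] [IsGalois ℚ K] (Q : IntermediateField ℚ K)
variable (p : ℕ) (𝔭 : Ideal (𝓞 K)) [h𝔭P : 𝔭.IsPrime] [h𝔭 : 𝔭.LiesOver (Ideal.span {(p : ℤ)})]

/-- **`D = D(w₀) ⊂ Γ`, the decomposition group of the prime `w₀ = 𝔭_{w₀}` of `K`**: the stabilizer of `w₀ ∈ Y` in `Γ = Gal(K/ℚ)`
(Mathlib `MulAction.stabilizer` for the action of `Gal(K/ℚ)` on the primes over `p`, as in Mathlib's Hilbert theory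
`IsDecompositionField`). [cite: Milne1999, §6 p. 69 L8–L9 («Let D = D(w₀) ⊂ Γ be the decomposition group of w₀»)] -/
abbrev decompositionGroup : Subgroup (K ≃ₐ[ℚ] K) := MulAction.stabilizer (K ≃ₐ[ℚ] K) (basePrime p 𝔭)

omit [IsCMField K] [IsGalois ℚ K] in
/-- [cite: Milne1999, §6 p. 69 L8–L9] -/
theorem mem_decompositionGroup_iff (σ : K ≃ₐ[ℚ] K) : σ ∈ decompositionGroup p 𝔭 ↔ σ • basePrime p 𝔭 = basePrime p 𝔭 :=
  MulAction.mem_stabilizer_iff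

omit [IsCMField K] [IsGalois ℚ K] in
/-- `σ ∈ D(w₀)` iff `σ(𝔭_{w₀}) = 𝔭_{w₀}` as ideals of `𝓞_K` (pointwise action). [cite: Milne1999, §6 p. 69 L8–L9] -/
theorem mem_decompositionGroup_iff_smul_eq (σ : K ≃ₐ[ℚ] K) : σ ∈ decompositionGroup p 𝔭 ↔ σ • 𝔭 = 𝔭 := by
  rw [mem_decompositionGroup_iff, Subtype.ext_iff, coe_algEquiv_smul_primesOver]

omit [IsCMField K] in
/-- **«`d = (D : 1)`» is `[K_{w₀} : ℚ_p] = e(w₀/p)·f(w₀/p)`** (g16-#3 `card_fibre_basePrime`: `D = fib(w₀)`).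
[cite: Milne1999, §6 p. 69 L12 («Let d = (D : 1)»)] [cite: NeukirchANT1999, Ch. I §9 (|G_𝔓| = e·f)] -/
theorem card_decompositionGroup [Fact p.Prime] : Nat.card (decompositionGroup p 𝔭) = localDegree 𝔭 := by
  classical
  rw [← card_fibre_basePrime p 𝔭, fibre_eq_filter, Nat.card_eq_fintype_card]
  change Fintype.card {σ : K ≃ₐ[ℚ] K // σ ∈ MulAction.stabilizer (K ≃ₐ[ℚ] K) (basePrime p 𝔭)} = _
  simp_rw [MulAction.mem_stabilizer_iff]
  rw [Fintype.card_subtype]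

omit [IsCMField K] in
/-- **«We shall use the map `τ ↦ τw₀` to identify `Γ/D` with the set of primes of `K` lying over `p`»**: `Γ/D(w₀) ≃ Y`,
`τD ↦ τw₀` (orbit–stabilizer; `Gal(K/ℚ)` is transitive on `Y`, g16-#3 `isPretransitive_algEquiv_primesOverSet`).
[cite: Milne1999, §6 p. 69 L16–L17] -/
def cosetsEquivPrimesOver : (K ≃ₐ[ℚ] K) ⧸ decompositionGroup p 𝔭 ≃ primesOverSet p K :=
  (MulAction.orbitEquivQuotientStabilizer (K ≃ₐ[ℚ] K) (basePrime p 𝔭)).symm.trans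
    ((Equiv.setCongr (MulAction.orbit_eq_univ (K ≃ₐ[ℚ] K) (basePrime p 𝔭))).trans (Equiv.Set.univ _))

omit [IsCMField K] in
/-- `τD ↦ τw₀`. [cite: Milne1999, §6 p. 69 L16–L17] -/
@[simp] theorem cosetsEquivPrimesOver_mk (τ : K ≃ₐ[ℚ] K) :
    cosetsEquivPrimesOver p 𝔭 (τ : (K ≃ₐ[ℚ] K) ⧸ decompositionGroup p 𝔭) = τ • basePrime p 𝔭 := by
  simp only [cosetsEquivPrimesOver, Equiv.trans_apply]
  change ((MulAction.orbitEquivQuotientStabilizer (K ≃ₐ[ℚ] K) (basePrime p 𝔭)).symm ↑τ : primesOverSet p K) = _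
  exact MulAction.orbitEquivQuotientStabilizer_symm_apply _ _ _

omit [IsCMField K] in
/-- The identification is `Γ`-equivariant: `γ·(τD) ↦ γ(τw₀)`. [cite: Milne1999, §6 p. 69 L16–L17] -/
theorem cosetsEquivPrimesOver_smul (γ : K ≃ₐ[ℚ] K) (c : (K ≃ₐ[ℚ] K) ⧸ decompositionGroup p 𝔭) :
    cosetsEquivPrimesOver p 𝔭 (γ • c) = γ • cosetsEquivPrimesOver p 𝔭 c := by
  induction c using QuotientGroup.induction_on with | H τ => ?_
  rw [MulAction.Quotient.smul_coe, smul_eq_mul, cosetsEquivPrimesOver_mk, cosetsEquivPrimesOver_mk]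
  -- on the underlying ideals (the `galRestrict` action on `Y` is the pointwise one, g16-#1 `coe_algEquiv_smul_primesOver`)
  apply Subtype.ext
  rw [coe_algEquiv_smul_primesOver, coe_algEquiv_smul_primesOver, coe_algEquiv_smul_primesOver, mul_smul]

omit [IsCMField K] in
/-- `|Y| · (D : 1) = |Γ| = [K : ℚ]`. [cite: Milne1999, §6 p. 69 L12–L17] -/
theorem card_primesOverSet_mul_card_decompositionGroup :
    Nat.card (primesOverSet p K) * Nat.card (decompositionGroup p 𝔭) = Module.finrank ℚ K := by
  rw [← Nat.card_congr (cosetsEquivPrimesOver p 𝔭), ← IsGalois.card_aut_eq_finrank,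
    ← Subgroup.card_eq_card_quotient_mul_card_subgroup (decompositionGroup p 𝔭)]

omit [IsCMField K] [IsGalois ℚ K] h𝔭P h𝔭 in
/-- An automorphism of `K` over `Q` does not move the prime of `Q` below an ideal of `𝓞_K`: `(τP) ∩ 𝓞_Q = P ∩ 𝓞_Q` for `τ ∈ Gal(K/Q)`.
[cite: Milne1999, §6 p. 69 L9 («Because p splits in Q, D ⊂ Γ₀»)] [cite: NeukirchANT1999, Ch. I §9] -/
theorem under_smul_of_mem_fixingSubgroup {τ : K ≃ₐ[ℚ] K} (hτ : τ ∈ Q.fixingSubgroup) (P : Ideal (𝓞 K)) :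
    (τ • P).under (𝓞 Q) = P.under (𝓞 Q) := by
  ext x
  have hx : τ • (algebraMap (𝓞 Q) (𝓞 K) x) = algebraMap (𝓞 Q) (𝓞 K) x := by
    apply RingOfIntegers.coe_injective
    change τ (((x : Q) : K)) = ((x : Q) : K)
    exact (IntermediateField.mem_fixingSubgroup_iff Q τ).1 hτ _ (x : Q).2
  rw [Ideal.under_def, Ideal.under_def, Ideal.mem_comap, Ideal.mem_comap]
  constructor
  · intro h
    rwa [← hx, Ideal.smul_mem_pointwise_smul_iff] at h
  · intro h
    rw [← hx]
    exact Ideal.smul_mem_pointwise_smul_iff.2 h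

omit [IsGalois ℚ K] h𝔭P h𝔭 in
/-- For `τ ∈ Gal(K/Q)`: `(ιτP) ∩ 𝓞_Q = (ιP) ∩ 𝓞_Q` (`ι` is central). [cite: Milne1999, §6 p. 69 L9] -/
theorem under_conjGal_mul_smul {τ : K ≃ₐ[ℚ] K} (hτ : τ ∈ Q.fixingSubgroup) (P : Ideal (𝓞 K)) :
    ((conjGal * τ) • P).under (𝓞 Q) = ((conjGal : K ≃ₐ[ℚ] K) • P).under (𝓞 Q) := by
  rw [conjGal_central τ, mul_smul, under_smul_of_mem_fixingSubgroup Q hτ]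

omit [IsCMField K] [IsGalois ℚ K] h𝔭P h𝔭 in
/-- The prime `𝔭 ∩ 𝓞_Q` of `Q` below a prime `𝔭 | p` of `K` lies over `p`. [cite: NeukirchANT1999, Ch. I §9] -/
theorem under_mem_primesOver (P : primesOverSet p K) : P.1.under (𝓞 Q) ∈ (Ideal.span {(p : ℤ)}).primesOver (𝓞 Q) :=
  ⟨Ideal.IsPrime.under _ P.1, Ideal.under_liesOver_of_liesOver _ P.1 _⟩

/-- **«Because `p` splits in `Q`, `D ⊂ Γ₀`»**: if `Q ⊂ K` is a quadratic subfield not fixed by `ι` (imaginary quadratic) in which `p`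
splits — `p𝓞_Q` has two distinct prime factors, i.e. there are two primes of `Q` over `p` — then the decomposition group `D(w₀)` of any
prime `w₀ | p` of `K` is contained in `Γ₀ = Gal(K/Q)`.  Proof: let `v₀ = w₀ ∩ Q` and `v ≠ v₀` the other prime of `Q` over `p`; a prime
`w | v` of `K` is `σw₀` (`Γ` transitive on `Y`), and `σ ∉ Γ₀` (else `w ∩ Q = v₀`), so `σ = ιτ`, `τ ∈ Γ₀`, and `(ιw₀) ∩ Q = (ιτw₀) ∩ Q = v`;
if `δ ∈ D ∖ Γ₀` then `δ = ιτ′`, `τ′ ∈ Γ₀`, and `v₀ = (δw₀) ∩ Q = (ιw₀) ∩ Q = v` — contradiction.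
[cite: Milne1999, §6 p. 69 L9] [cite: NeukirchANT1999, Ch. I (8.3), §9] -/
theorem decompositionGroup_le_fixingSubgroup (hQ : Module.finrank ℚ Q = 2) (hι : (conjGal : K ≃ₐ[ℚ] K) ∉ Q.fixingSubgroup)
    (hsplit : ((Ideal.span {(p : ℤ)}).primesOver (𝓞 Q)).ncard = 2) :
    decompositionGroup p 𝔭 ≤ Q.fixingSubgroup := by
  classical
  -- the prime `v₀ = w₀ ∩ Q` and another prime `v ≠ v₀` of `Q` over `p`
  set v₀ : Ideal (𝓞 Q) := 𝔭.under (𝓞 Q) with hv₀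
  have hv₀mem : v₀ ∈ (Ideal.span {(p : ℤ)}).primesOver (𝓞 Q) := under_mem_primesOver Q p (basePrime p 𝔭)
  obtain ⟨v, hvmem, hvne⟩ : ∃ v ∈ (Ideal.span {(p : ℤ)}).primesOver (𝓞 Q), v ≠ v₀ := by
    obtain ⟨a, b, hab, hset⟩ := Set.ncard_eq_two.1 hsplit
    by_cases ha : a = v₀
    · refine ⟨b, ?_, ?_⟩
      · rw [hset]; exact Or.inr rfl
      · rw [← ha]; exact hab.symm
    · refine ⟨a, ?_, ha⟩
      rw [hset]; exact Or.inl rfl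
  -- a prime `w` of `K` over `v`; it lies over `p`, so `w = σw₀`
  haveI : v.IsPrime := hvmem.1
  obtain ⟨⟨P, hPprime, hPover⟩⟩ := Ideal.nonempty_primesOver (S := 𝓞 K) v
  haveI : v.LiesOver (Ideal.span {(p : ℤ)}) := hvmem.2
  haveI : P.LiesOver (Ideal.span {(p : ℤ)}) := Ideal.LiesOver.trans P v _
  obtain ⟨σ, hσ⟩ := exists_smul_basePrime_eq p 𝔭 ⟨P, hPprime, inferInstance⟩
  have hσP : (σ • 𝔭).under (𝓞 Q) = v := by
    have h1 : ((σ • basePrime p 𝔭 : primesOverSet p K) : Ideal (𝓞 K)) = P := by rw [hσ]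
    rw [coe_algEquiv_smul_primesOver] at h1
    change σ • 𝔭 = P at h1
    rw [h1]
    exact hPover.over.symm
  -- `σ ∉ Γ₀`, so `σ = ιτ` with `τ ∈ Γ₀`, and `(ιw₀) ∩ Q = v`
  have hσnot : σ ∉ Q.fixingSubgroup := fun hσ0 => hvne (by rw [← hσP, under_smul_of_mem_fixingSubgroup Q hσ0])
  have hιτ : conjGal * σ ∈ Q.fixingSubgroup := (mem_or_conjGal_mul_mem Q hQ hι σ).resolve_left hσnot
  have hιP : ((conjGal : K ≃ₐ[ℚ] K) • 𝔭).under (𝓞 Q) = v := by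
    have : σ = conjGal * (conjGal * σ) := by rw [← mul_assoc, conjGal_mul_conjGal, one_mul]
    rw [← hσP, this, under_conjGal_mul_smul Q hιτ]
  -- now `δ ∈ D ∖ Γ₀` is impossible
  intro δ hδ
  by_contra hδnot
  have hιδ : conjGal * δ ∈ Q.fixingSubgroup := (mem_or_conjGal_mul_mem Q hQ hι δ).resolve_left hδnot
  have hδP : δ • 𝔭 = 𝔭 := (mem_decompositionGroup_iff_smul_eq p 𝔭 δ).1 hδ
  apply hvne
  have hδ' : δ = conjGal * (conjGal * δ) := by rw [← mul_assoc, conjGal_mul_conjGal, one_mul]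
  calc v = ((conjGal : K ≃ₐ[ℚ] K) • 𝔭).under (𝓞 Q) := hιP.symm
    _ = ((conjGal * (conjGal * δ)) • 𝔭).under (𝓞 Q) := by rw [under_conjGal_mul_smul Q hιδ]
    _ = (δ • 𝔭).under (𝓞 Q) := by rw [← hδ']
    _ = v₀ := by rw [hδP]

end Primes

/-! ### §4 The number-theoretic instance of `CosetGerm.Setting` -/

section TheSetting

variable {K : Type} [Field K] [NumberField K] [IsCMField K] [IsGalois ℚ K] (Q : IntermediateField ℚ K)
variable (p : ℕ) (𝔭 : Ideal (𝓞 K)) [h𝔭P : 𝔭.IsPrime] [h𝔭 : 𝔭.LiesOver (Ideal.span {(p : ℤ)})]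

/-- **The Galois-theoretic `Setting`**: for a quadratic subfield `Q ⊂ K` not fixed by `ι` and ANY subgroup `D ⊂ Γ₀ = Gal(K/Q)`, g17-#2's
`CosetGerm.Setting ι Γ₀ D` holds with `ι = conjGal` («`Γ = Γ₀ × ⟨ι⟩`»: `ι` central of order `2`, `ι ∉ Γ₀`, `Γ = Γ₀ ∪ ιΓ₀`, `D ⊂ Γ₀`).
[cite: Milne1999, §6 p. 69 L1–L11] -/
theorem cosetGermSetting_of_le (hQ : Module.finrank ℚ Q = 2) (hι : (conjGal : K ≃ₐ[ℚ] K) ∉ Q.fixingSubgroup)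
    {D : Subgroup (K ≃ₐ[ℚ] K)} (hD : D ≤ Q.fixingSubgroup) : CosetGerm.Setting (conjGal : K ≃ₐ[ℚ] K) Q.fixingSubgroup D where
  comm := conjGal_central
  mul_self := conjGal_mul_conjGal
  not_mem := hι
  mem_or_mem := mem_or_conjGal_mul_mem Q hQ hι
  le := hD

/-- **THE NUMBER-THEORETIC INSTANCE OF `CosetGerm.Setting`** («Thus `K = Q · F` …, `Γ = Γ₀ × ⟨ι⟩`, `Γ₀ = Gal(K/Q)` … Let `D = D(w₀) ⊂ Γ`
be the decomposition group of `w₀`. Because `p` splits in `Q`, `D ⊂ Γ₀`.»): for a CM field `K` Galois over `ℚ`, an imaginary (= not totally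
real) quadratic subfield `Q` in which `p` splits, and a prime `w₀ | p` of `K`, the data `Γ = Gal(K/ℚ) ⊇ Γ₀ = Gal(K/Q) ⊇ D = D(w₀)`,
`ι = conjGal` satisfy g17-#2's `Setting` — so every result of g17-#2…#5 (LEMMAS 6.7–6.10, THEOREM 6.1 at level `K` on characters)
applies to it. [cite: Milne1999, §6 p. 68 L-1 – p. 69 L11] -/
theorem cosetGermSetting (hQ : Module.finrank ℚ Q = 2) (hQi : ¬IsTotallyReal Q)
    (hsplit : ((Ideal.span {(p : ℤ)}).primesOver (𝓞 Q)).ncard = 2) :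
    CosetGerm.Setting (conjGal : K ≃ₐ[ℚ] K) Q.fixingSubgroup (decompositionGroup p 𝔭) :=
  cosetGermSetting_of_le Q hQ ((conjGal_not_mem_fixingSubgroup_iff Q).2 hQi)
    (decompositionGroup_le_fixingSubgroup Q p 𝔭 hQ ((conjGal_not_mem_fixingSubgroup_iff Q).2 hQi) hsplit)

/-- `ι ∉ D(w₀)` when `p` splits in `Q` (`ι ∉ Γ₀ ⊇ D`). [cite: Milne1999, §6 p. 69 L9] -/
theorem conjGal_not_mem_decompositionGroup (hQ : Module.finrank ℚ Q = 2) (hQi : ¬IsTotallyReal Q)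
    (hsplit : ((Ideal.span {(p : ℤ)}).primesOver (𝓞 Q)).ncard = 2) : (conjGal : K ≃ₐ[ℚ] K) ∉ decompositionGroup p 𝔭 :=
  fun h => (cosetGermSetting Q p 𝔭 hQ hQi hsplit).not_mem ((cosetGermSetting Q p 𝔭 hQ hQi hsplit).le h)

omit h𝔭P h𝔭 in
/-- Consequence read back on the primes («`Γ = {τ₀, …, ιτ₀, …}`», `Γ/D = {σ_i} ⊔ {ισ_i}`): **when `p` splits in `Q`, complex conjugation
fixes NO prime of `K` above `p`** — `ιw ≠ w` for every `w | p`. [cite: Milne1999, §6 p. 69 L9–L17] -/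
theorem conjGal_smul_ne (hQ : Module.finrank ℚ Q = 2) (hQi : ¬IsTotallyReal Q)
    (hsplit : ((Ideal.span {(p : ℤ)}).primesOver (𝓞 Q)).ncard = 2) (w : primesOverSet p K) :
    (conjGal : K ≃ₐ[ℚ] K) • w ≠ w := by
  haveI : w.1.IsPrime := w.2.1
  haveI : w.1.LiesOver (Ideal.span {(p : ℤ)}) := w.2.2
  have h := conjGal_not_mem_decompositionGroup Q p w.1 hQ hQi hsplit
  rwa [mem_decompositionGroup_iff] at h

/-- `Γ₀` is a CM type on the `Γ`-set `Γ` for `ι` (skel-3's `IsCMTypeWith`, through g17-#2 `Setting.isCMTypeWith`): «`Γ = {τ₀, …, τ_{n−1},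
ιτ₀, …, ιτ_{n−1}}`». [cite: Milne1999, §6 p. 69 L10–L11] -/
theorem isCMTypeWith_fixingSubgroup (hQ : Module.finrank ℚ Q = 2) (hQi : ¬IsTotallyReal Q) :
    IsCMTypeWith (conjGal : K ≃ₐ[ℚ] K) (Q.fixingSubgroup : Set (K ≃ₐ[ℚ] K)) :=
  (cosetGermSetting_of_le Q hQ ((conjGal_not_mem_fixingSubgroup_iff Q).2 hQi) bot_le).isCMTypeWith

end TheSetting

end CMNumbers

end Literature.NumberTheory.ComplexMultiplication
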